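import Literature.NumberTheory.GaloisRepresentations.LubinTateColemanRelativeInterpolationTwo
import HarnessLib

set_option linter.dupNamespace false -- cosmetic (namespace repeats `BirchSwinnertonDyer`); drop at port

/-!
# STUB-IDEAS k3 (gen 41) — «THE LOCAL UNTWIST EXISTS, IS UNIQUE, AND IS `σ₀^K| · σ_{χ_π(σ₀^K)⁻¹ v}`»
# R217 «LOCAL-UNTWIST₂», EXISTENCE HALF: k3-g40's typed sub-stub `LocalUntwistExists` PROVED (0 sorry)

Stub-ideation sketch for `stub_heegnerIndexLowerAtTwo` (ACTIVE skeleton `f2bd84c029a8a938`, route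
`PrintCf2`, crux `SplitBadTwoLowerHalfOfFacts` = `stmt-BirchSwinnertonDyer-27851`), technique
«decomposition into sub-stubs with a PROVED glue».  BSD is NOT proved by any of this; the stub of record is
FIXED and not re-typed; this file closes ONE input of R219 «READ₂» (STUB-PLAN v7.3 §4 (iii) (ρ3), ORDER NOW B′
lane «R217 (S)»): the EXISTENCE of the local untwisting automorphism, typed by k3-g40 as the open crux
`ReadTwoCutK3G40.LocalUntwistExists` (its K2, XS–S) and consumed by its `exists_untwisted_table`.

NODE (verbatim from k3-g40 §4): for `E ⊆ F^{nr}` finite normal, `σ₀ ∈ Γ_F`, every level `m`, exponent `K`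
and unit `v ∈ 𝒪_F^×` there is `τ ∈ Aut_F(E·K_π^{m+1})` acting on `𝒪_E` as `φ^K` (`φ = frobUnitBall E σ₀`)
and moving `ι ω_{m+1}` exactly as `σ_v = relGalOfUnit v` does.

DECOMPOSITION (all three sub-stubs DISCHARGED, glue PROVED ⇒ the node is CLOSED):
* U1 `UnitValuedFrobRestriction` — the restriction `ρ_K = σ₀^K|_{E·K_π^{m+1}}` moves `λ'` through a unit
  (`ρ_K [a]λ' = [w a]λ'`, in fact `w = χ_π(σ₀^K)`): tree `exists_unit_mapPt_eq_relAct` / `mapPt_relRestrict_relAct`;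
* U2 `UnitRealisedFixingE` — every unit `u` is realised on `λ'` by an automorphism fixing `E` pointwise
  (linear disjointness `E ∩ K_π^{m+1} = F`): tree `relGalOfUnit`, `relGalOfUnit_apply_inclusion`,
  `mapPt_relGalOfUnit_relAct` (from `exists_absGal_fixing_smul_ltRoot_eq`);
* U3 `FrobRestrictionActs` — `ρ_K` acts on `𝒪_E` as `φ^K`: PROVED here (`coe_frobUnitBall_iterate`: both
  sides are `σ₀^K • x` in `F̄`, by `coe_relRestrict_apply` / `coe_restrictNormal_apply`);
* GLUE `localUntwistExists_of : U1 → U2 → U3 → LocalUntwistExists` — `τ := ρ_K ∘ σ_{w⁻¹ v}` (the actions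
  `[a]_f` commute with automorphisms, `mapPt_relAct'`): PROVED; hence ★ `localUntwistExists` PROVED.
Extras: ★ `localUntwist_unique` (an automorphism of `E·K_π^{m+1}` is determined by `φ^K` on `𝒪_E` — which
already pins it on `E`, `forall_apply_inclusion_of_forall_unitBall` — and by its value on the primitive point
`ι ω_{m+1} = [c_m]λ'`), the explicit untwist `localUntwist K v := σ₀^K| · σ_{χ_π(σ₀^K)⁻¹ v}` with its two
defining properties, `eq_localUntwist` (every untwist IS it), `localUntwist_add_mul` (`σ_loc` is a homomorphic
image of `ℕ × 𝒪_F^×` — de Shalit I §1.8 in Galois form, relative to `E`), the degenerate instance `K = 0`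
(`localUntwist 0 v = σ_v`, B68), and `localUntwistExists_offset` = the exact instance `hex m (m+1+k) v` that
k3-g40's `exists_untwisted_table` consumes.  §7: R222 «SHIFT₂» needs NO new theorem — `ϑ(−2 − x) = −π' − ϑ(x)`
is the tree's `coe_evalPt₁_compSeriesC_reflect` (`LubinTateComparisonReflectionTwo` ★★); the residual index
identity `ζ^{j+2^n} − 1 = −2 − (ζ^j − 1)` for a primitive `2^{n+1}`-th root `ζ` (general `n`) is kernel here.
-/

noncomputable section

namespace Summit.BirchSwinnertonDyer.BirchSwinnertonDyer.Cruxes.SplitBadTwoLowerHalfOfFacts.LocalUntwistK3G41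

open ValuativeRel IsLocalRing Field
open Literature.NumberTheory.GaloisRepresentations Literature.NumberTheory.GaloisRepresentations.IsNonarchimedeanLocalField
  Literature.NumberTheory.GaloisRepresentations.LubinTate

variable {F : Type} [Field F] [ValuativeRel F] [TopologicalSpace F] [IsNonarchimedeanLocalField F]

attribute [local instance] ltNormUniformSpace ltNormIsUniformAddGroup rk1 nF nE fintypeResidueField

variable {π : 𝒪[F]} (hπ : (valuation F).IsUniformizer (π : F))
variable (E : IntermediateField F (AlgebraicClosure F)) [FiniteDimensional F E] [Normal F E]

/-! ## §0. The node, VERBATIM from k3-g40 (`ReadTwoCutK3G40.ActsAsFrobPow`, `.LocalUntwistExists`) -/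

/-- "`τ ∈ Aut_F(E·K_π^{m+1})` acts on `𝒪_E` as `φ^K`" (`φ = frobUnitBall E σ₀`; `K` is NOT tied to the level).
VERBATIM k3-g40. -/
def ActsAsFrobPow (σ₀ : absoluteGaloisGroup F) (K : ℕ) {m : ℕ}
    (τ : (E ⊔ ltField π m : IntermediateField F (AlgebraicClosure F)) ≃ₐ[F]
      (E ⊔ ltField π m : IntermediateField F (AlgebraicClosure F))) : Prop :=
  ∀ x : unitBall E, τ (IntermediateField.inclusion le_sup_left (x : E)) =
    IntermediateField.inclusion le_sup_left
      (((((frobUnitBall E σ₀ : unitBall E ≃+* unitBall E) : unitBall E →+* unitBall E) :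
        unitBall E → unitBall E)^[K] x : unitBall E) : E)

/-- R217 EXISTENCE HALF (k3-g40's typed sub-stub, VERBATIM): for every level `m`, exponent `K` and unit `v` there is
`τ ∈ Aut_F(E·K_π^{m+1})` acting on `𝒪_E` as `φ^K` and moving `ι ω_{m+1}` as `σ_v` does. -/
def LocalUntwistExists (hE : E ≤ maxUnramified F) (σ₀ : absoluteGaloisGroup F) : Prop :=
  ∀ (m K : ℕ) (v : 𝒪[F]ˣ), ∃ τ : (E ⊔ ltField π m : IntermediateField F (AlgebraicClosure F)) ≃ₐ[F]
      (E ⊔ ltField π m : IntermediateField F (AlgebraicClosure F)),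
    ActsAsFrobPow E σ₀ K τ ∧
      mapPt τ (inclPt (le_sup_right : ltField π m ≤ E ⊔ ltField π m) (cohPt hπ m)) =
        mapPt (relGalOfUnit hπ E m hE v) (inclPt (le_sup_right : ltField π m ≤ E ⊔ ltField π m) (cohPt hπ m))

/-! ## §1. The three sub-stubs (typed) -/

/-- **U1** — the restricted Frobenius power `ρ_K = relRestrict (σ₀^K)` moves the base point `λ'` through a UNIT:
`ρ_K([a]λ') = [w·a]λ'` for some `w ∈ 𝒪_F^×` (uniformly in `a`). -/
def UnitValuedFrobRestriction (σ₀ : absoluteGaloisGroup F) : Prop :=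
  ∀ (m K : ℕ), ∃ w : 𝒪[F]ˣ, ∀ a : 𝒪[F],
    mapPt (relRestrict hπ E m (σ₀ ^ K)) (relAct hπ E m a (relGenPt hπ E m)) =
      relAct hπ E m ((w : 𝒪[F]) * a) (relGenPt hπ E m)

/-- **U2** — every unit `u` is realised on `λ'` by an `F`-automorphism of `E·K_π^{m+1}` FIXING `E` POINTWISE
(`E/F` unramified and `K_π^{m+1}/F` totally ramified are linearly disjoint). -/
def UnitRealisedFixingE : Prop :=
  ∀ (m : ℕ) (u : 𝒪[F]ˣ), ∃ σ : (E ⊔ ltField π m : IntermediateField F (AlgebraicClosure F)) ≃ₐ[F]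
      (E ⊔ ltField π m : IntermediateField F (AlgebraicClosure F)),
    (∀ x : E, σ (IntermediateField.inclusion le_sup_left x) = IntermediateField.inclusion le_sup_left x) ∧
      ∀ a : 𝒪[F], mapPt σ (relAct hπ E m a (relGenPt hπ E m)) = relAct hπ E m ((u : 𝒪[F]) * a) (relGenPt hπ E m)

/-- **U3** — `ρ_K = relRestrict (σ₀^K)` acts on `𝒪_E` as `φ^K`. -/
def FrobRestrictionActs (σ₀ : absoluteGaloisGroup F) : Prop :=
  ∀ (m K : ℕ), ActsAsFrobPow E σ₀ K (relRestrict hπ E m (σ₀ ^ K))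

/-! ## §2. GLUE (PROVED): `τ := ρ_K ∘ σ_{w⁻¹ v}` -/

omit [Normal F E] in
/-- `ι ω_{m+1} = [c_m]λ'` (`ω_{m+1} = [c_m]λ_{m+1}`, `c_m = cohUnit`). -/
theorem inclPt_cohPt_eq_relAct (m : ℕ) :
    inclPt (le_sup_right : ltField π m ≤ E ⊔ ltField π m) (cohPt hπ m) =
      relAct hπ E m (cohUnit hπ m : 𝒪[F]) (relGenPt hπ E m) := by
  rw [cohPt_eq]; exact inclPt_ltAct_genPt hπ E m _

/-- ★ **GLUE: U1 → U2 → U3 → R217∃.**  With `w` from U1 and `σ' = σ_{w⁻¹v}` from U2, `τ := ρ_K ∘ σ'` acts on `𝒪_E`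
as `ρ_K` does (U3: `φ^K`), and `τ([c]λ') = ρ_K([w⁻¹ v c]λ') = [w w⁻¹ v c]λ' = [v c]λ' = σ_v([c]λ')`. -/
theorem localUntwistExists_of (hE : E ≤ maxUnramified F) (σ₀ : absoluteGaloisGroup F)
    (h1 : UnitValuedFrobRestriction hπ E σ₀) (h2 : UnitRealisedFixingE hπ E) (h3 : FrobRestrictionActs hπ E σ₀) :
    LocalUntwistExists hπ E hE σ₀ := by
  intro m K v
  obtain ⟨w, hw⟩ := h1 m K
  obtain ⟨σ', hσ'E, hσ'pt⟩ := h2 m (w⁻¹ * v)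
  refine ⟨relRestrict hπ E m (σ₀ ^ K) * σ', fun x => ?_, ?_⟩
  · rw [AlgEquiv.mul_apply, hσ'E]
    exact h3 m K x
  · rw [inclPt_cohPt_eq_relAct, mapPt_mul, hσ'pt, hw, mapPt_relGalOfUnit_relAct, Units.val_mul, mul_assoc,
      Units.mul_inv_cancel_left]

/-! ## §3. The sub-stubs DISCHARGED -/

/-- U1 ✓ (tree: `exists_unit_mapPt_eq_relAct`; explicitly `w = χ_π(σ₀^K)` by `mapPt_relRestrict_relAct`). -/
theorem unitValuedFrobRestriction (σ₀ : absoluteGaloisGroup F) : UnitValuedFrobRestriction hπ E σ₀ :=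
  fun m K => ⟨lubinTateChar hπ (σ₀ ^ K), fun a => mapPt_relRestrict_relAct hπ E m (σ₀ ^ K) a⟩

/-- U2 ✓ (tree: `relGalOfUnit` — the Galois form of `E ∩ K_π^{m+1} = F`, `exists_absGal_fixing_smul_ltRoot_eq`). -/
theorem unitRealisedFixingE (hE : E ≤ maxUnramified F) : UnitRealisedFixingE hπ E :=
  fun m u => ⟨relGalOfUnit hπ E m hE u, relGalOfUnit_apply_inclusion hπ E m hE u,
    mapPt_relGalOfUnit_relAct hπ E m hE u⟩

/-- `φ = σ₀|` on `𝒪_E`, read in `F̄`. -/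
theorem coe_frobUnitBall_apply (σ₀ : absoluteGaloisGroup F) (x : unitBall E) :
    ((((((frobUnitBall E σ₀ : unitBall E ≃+* unitBall E) : unitBall E →+* unitBall E) :
        unitBall E → unitBall E) x : unitBall E) : E) : AlgebraicClosure F) =
      σ₀ • ((x : E) : AlgebraicClosure F) := by
  change ((((absoluteGaloisGroup.toAlgEquiv F σ₀).restrictNormal E) (x : E) : E) : AlgebraicClosure F) = _
  exact coe_restrictNormal_apply E σ₀ (x : E)

/-- `φ^[K] = σ₀^K|` on `𝒪_E`, read in `F̄`. -/
theorem coe_frobUnitBall_iterate (σ₀ : absoluteGaloisGroup F) (K : ℕ) (x : unitBall E) :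
    ((((((frobUnitBall E σ₀ : unitBall E ≃+* unitBall E) : unitBall E →+* unitBall E) :
        unitBall E → unitBall E)^[K] x : unitBall E) : E) : AlgebraicClosure F) =
      (σ₀ ^ K) • ((x : E) : AlgebraicClosure F) := by
  induction K with
  | zero => rw [Function.iterate_zero_apply, pow_zero, one_smul]
  | succ K ih => rw [Function.iterate_succ_apply', coe_frobUnitBall_apply, ih, ← mul_smul, ← pow_succ']

/-- U3 ✓: `relRestrict (σ₀^K)` acts on `𝒪_E` as `φ^K` (both sides are `σ₀^K • x` in `F̄`). -/
theorem frobRestrictionActs (σ₀ : absoluteGaloisGroup F) : FrobRestrictionActs hπ E σ₀ := by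
  intro m K x
  apply Subtype.ext
  rw [coe_relRestrict_apply, IntermediateField.coe_inclusion, IntermediateField.coe_inclusion,
    coe_frobUnitBall_iterate]

/-! ## §4. ★ R217 EXISTENCE HALF — PROVED -/

/-- ★★ **`LocalUntwistExists` holds** (k3-g40's K2 closed): for every `m K v` the untwist exists. -/
theorem localUntwistExists (hE : E ≤ maxUnramified F) (σ₀ : absoluteGaloisGroup F) :
    LocalUntwistExists hπ E hE σ₀ :=
  localUntwistExists_of hπ E hE σ₀ (unitValuedFrobRestriction hπ E σ₀) (unitRealisedFixingE hπ E hE)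
    (frobRestrictionActs hπ E σ₀)

/-! ## §5. UNIQUENESS (PROVED): the untwist is pinned by `φ^K` on `𝒪_E` and by its value on `ι ω_{m+1}` -/

omit [Normal F E] in
/-- An `F`-automorphism of `E·K_π^{m+1}` fixing `𝒪_E` pointwise fixes `E` pointwise (every `x ∈ E` lies in `𝒪_E`
or is the inverse of an element of `𝒪_E`). -/
theorem forall_apply_inclusion_of_forall_unitBall {m : ℕ}
    {σ : (E ⊔ ltField π m : IntermediateField F (AlgebraicClosure F)) ≃ₐ[F]
      (E ⊔ ltField π m : IntermediateField F (AlgebraicClosure F))}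
    (h : ∀ x : unitBall E, σ (IntermediateField.inclusion le_sup_left (x : E)) =
      IntermediateField.inclusion le_sup_left (x : E)) (x : E) :
    σ (IntermediateField.inclusion le_sup_left x) = IntermediateField.inclusion le_sup_left x := by
  by_cases hx : ‖x‖ ≤ 1
  · exact h ⟨x, (mem_unitBall_iff E).mpr hx⟩
  · have hx1 : 1 < ‖x‖ := not_le.mp hx
    have hinv : ‖x⁻¹‖ ≤ 1 := by rw [norm_inv]; exact inv_le_one_of_one_le₀ hx1.le
    have h1 : σ (IntermediateField.inclusion le_sup_left x⁻¹) = IntermediateField.inclusion le_sup_left x⁻¹ :=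
      h ⟨x⁻¹, (mem_unitBall_iff E).mpr hinv⟩
    rwa [map_inv₀, map_inv₀, inv_inj] at h1

/-- ★ **UNIQUENESS of the local untwist**: two automorphisms of `E·K_π^{m+1}` acting on `𝒪_E` as `φ^K` and agreeing
on `ι ω_{m+1}` are equal (`τ₁⁻¹τ₂` fixes `E` pointwise and the primitive point `[c_m]λ'`; tree
`algEquiv_eq_of_mapPt_relAct_eq`).  So R217's `τ` is CANONICAL — row 110's `σ_loc`. -/
theorem localUntwist_unique (σ₀ : absoluteGaloisGroup F) {m K : ℕ}
    {τ₁ τ₂ : (E ⊔ ltField π m : IntermediateField F (AlgebraicClosure F)) ≃ₐ[F]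
      (E ⊔ ltField π m : IntermediateField F (AlgebraicClosure F))}
    (h₁ : ActsAsFrobPow E σ₀ K τ₁) (h₂ : ActsAsFrobPow E σ₀ K τ₂)
    (hpt : mapPt τ₁ (inclPt (le_sup_right : ltField π m ≤ E ⊔ ltField π m) (cohPt hπ m)) =
      mapPt τ₂ (inclPt (le_sup_right : ltField π m ≤ E ⊔ ltField π m) (cohPt hπ m))) :
    τ₁ = τ₂ := by
  rw [← inv_mul_eq_one]
  refine algEquiv_eq_of_mapPt_relAct_eq hπ E m (cohUnit hπ m) (fun x => ?_) (fun _ => rfl) ?_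
  · refine forall_apply_inclusion_of_forall_unitBall E (fun y => ?_) x
    rw [AlgEquiv.mul_apply, h₂ y, ← h₁ y, AlgEquiv.aut_inv, AlgEquiv.symm_apply_apply]
  · rw [← inclPt_cohPt_eq_relAct, mapPt_mul, ← hpt, ← mapPt_mul, inv_mul_cancel]

/-! ## §6. The EXPLICIT untwist `σ_loc(K, v) = σ₀^K| ∘ σ_{χ_π(σ₀^K)⁻¹ v}` and the degenerate instance `K = 0` -/

/-- **The explicit local untwist** `σ_loc(K, v) := σ₀^K|_{E·K_π^{m+1}} ∘ σ_{χ_π(σ₀^K)⁻¹·v}` (`χ_π = lubinTateChar`,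
the Lubin–Tate character of `Γ_F`; `σ_u = relGalOfUnit u`). -/
def localUntwist (hE : E ≤ maxUnramified F) (σ₀ : absoluteGaloisGroup F) (m K : ℕ) (v : 𝒪[F]ˣ) :
    (E ⊔ ltField π m : IntermediateField F (AlgebraicClosure F)) ≃ₐ[F]
      (E ⊔ ltField π m : IntermediateField F (AlgebraicClosure F)) :=
  relRestrict hπ E m (σ₀ ^ K) * relGalOfUnit hπ E m hE ((lubinTateChar hπ (σ₀ ^ K))⁻¹ * v)

/-- `σ_loc(K, v)` acts on `𝒪_E` as `φ^K`. -/
theorem localUntwist_actsAsFrobPow (hE : E ≤ maxUnramified F) (σ₀ : absoluteGaloisGroup F) (m K : ℕ) (v : 𝒪[F]ˣ) :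
    ActsAsFrobPow E σ₀ K (localUntwist hπ E hE σ₀ m K v) := fun x => by
  rw [localUntwist, AlgEquiv.mul_apply, relGalOfUnit_apply_inclusion]
  exact frobRestrictionActs hπ E σ₀ m K x

/-- `σ_loc(K, v)([a]λ') = [v·a]λ'` — on the torsion `σ_loc(K, v)` IS `σ_v`, for every `a`. -/
theorem mapPt_localUntwist_relAct (hE : E ≤ maxUnramified F) (σ₀ : absoluteGaloisGroup F) (m K : ℕ) (v : 𝒪[F]ˣ)
    (a : 𝒪[F]) :
    mapPt (localUntwist hπ E hE σ₀ m K v) (relAct hπ E m a (relGenPt hπ E m)) =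
      relAct hπ E m ((v : 𝒪[F]) * a) (relGenPt hπ E m) := by
  rw [localUntwist, mapPt_mul, mapPt_relGalOfUnit_relAct, mapPt_relRestrict_relAct, Units.val_mul, mul_assoc,
    Units.mul_inv_cancel_left]

/-- `σ_loc(K, v)(ι ω_{m+1}) = σ_v(ι ω_{m+1})`. -/
theorem mapPt_localUntwist_cohPt (hE : E ≤ maxUnramified F) (σ₀ : absoluteGaloisGroup F) (m K : ℕ) (v : 𝒪[F]ˣ) :
    mapPt (localUntwist hπ E hE σ₀ m K v) (inclPt (le_sup_right : ltField π m ≤ E ⊔ ltField π m) (cohPt hπ m)) =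
      mapPt (relGalOfUnit hπ E m hE v) (inclPt (le_sup_right : ltField π m ≤ E ⊔ ltField π m) (cohPt hπ m)) := by
  rw [inclPt_cohPt_eq_relAct, mapPt_localUntwist_relAct, mapPt_relGalOfUnit_relAct]

/-- ★ Every untwist IS `σ_loc(K, v)` (existence + uniqueness packaged). -/
theorem eq_localUntwist (hE : E ≤ maxUnramified F) (σ₀ : absoluteGaloisGroup F) {m K : ℕ} (v : 𝒪[F]ˣ)
    {τ : (E ⊔ ltField π m : IntermediateField F (AlgebraicClosure F)) ≃ₐ[F]
      (E ⊔ ltField π m : IntermediateField F (AlgebraicClosure F))}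
    (hτ : ActsAsFrobPow E σ₀ K τ)
    (hpt : mapPt τ (inclPt (le_sup_right : ltField π m ≤ E ⊔ ltField π m) (cohPt hπ m)) =
      mapPt (relGalOfUnit hπ E m hE v) (inclPt (le_sup_right : ltField π m ≤ E ⊔ ltField π m) (cohPt hπ m))) :
    τ = localUntwist hπ E hE σ₀ m K v :=
  localUntwist_unique hπ E σ₀ hτ (localUntwist_actsAsFrobPow hπ E hE σ₀ m K v)
    (by rw [hpt, mapPt_localUntwist_cohPt])

/-- `σ_loc` is a homomorphic image of `ℕ × 𝒪_F^×`: `σ_loc(K₁ + K₂, v₁v₂) = σ_loc(K₁, v₁) ∘ σ_loc(K₂, v₂)` — the Galois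
form of `Gal(E·K_π^{m+1}/F) ⊇ ⟨φ⟩ × (𝒪_F/π^{m+1})^×` (de Shalit I §1.8, relative situation). -/
theorem localUntwist_add_mul (hE : E ≤ maxUnramified F) (σ₀ : absoluteGaloisGroup F) (m K₁ K₂ : ℕ) (v₁ v₂ : 𝒪[F]ˣ) :
    localUntwist hπ E hE σ₀ m (K₁ + K₂) (v₁ * v₂) =
      localUntwist hπ E hE σ₀ m K₁ v₁ * localUntwist hπ E hE σ₀ m K₂ v₂ := by
  symm
  refine eq_localUntwist hπ E hE σ₀ (v₁ * v₂) (fun x => ?_) ?_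
  · rw [AlgEquiv.mul_apply, localUntwist_actsAsFrobPow hπ E hE σ₀ m K₂ v₂ x,
      localUntwist_actsAsFrobPow hπ E hE σ₀ m K₁ v₁, ← Function.iterate_add_apply, Nat.add_comm]
  · rw [inclPt_cohPt_eq_relAct, mapPt_mul, mapPt_localUntwist_relAct, mapPt_localUntwist_relAct,
      mapPt_relGalOfUnit_relAct, Units.val_mul, mul_assoc]

/-- `σ_v` acts on `𝒪_E` as `φ^0 = id`. -/
theorem actsAsFrobPow_zero_relGalOfUnit (hE : E ≤ maxUnramified F) (σ₀ : absoluteGaloisGroup F) (m : ℕ) (v : 𝒪[F]ˣ) :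
    ActsAsFrobPow E σ₀ 0 (relGalOfUnit hπ E m hE v) :=
  fun x => relGalOfUnit_apply_inclusion hπ E m hE v (x : E)

/-- DEGENERATE INSTANCE (B68) `K = 0`: the untwist is `σ_v` itself (`χ_π(1) = 1`, no Frobenius to undo). -/
theorem localUntwist_zero (hE : E ≤ maxUnramified F) (σ₀ : absoluteGaloisGroup F) (m : ℕ) (v : 𝒪[F]ˣ) :
    localUntwist hπ E hE σ₀ m 0 v = relGalOfUnit hπ E m hE v :=
  (eq_localUntwist hπ E hE σ₀ v (actsAsFrobPow_zero_relGalOfUnit hπ E hE σ₀ m v) rfl).symm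

/-- THE INSTANCE k3-g40's `exists_untwisted_table` consumes (`hex m (m + 1 + k) v`): at Frobenius offset `k` over
level `m` the untwist acts on `𝒪_E` as `φ^{m+1+k}` — now hypothesis-free. -/
theorem localUntwistExists_offset (hE : E ≤ maxUnramified F) (σ₀ : absoluteGaloisGroup F) (m k : ℕ) (v : 𝒪[F]ˣ) :
    ∃ τ : (E ⊔ ltField π m : IntermediateField F (AlgebraicClosure F)) ≃ₐ[F]
        (E ⊔ ltField π m : IntermediateField F (AlgebraicClosure F)),
      ActsAsFrobPow E σ₀ (m + 1 + k) τ ∧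
        mapPt τ (inclPt (le_sup_right : ltField π m ≤ E ⊔ ltField π m) (cohPt hπ m)) =
          mapPt (relGalOfUnit hπ E m hE v) (inclPt (le_sup_right : ltField π m ≤ E ⊔ ltField π m) (cohPt hπ m)) :=
  localUntwistExists hπ E hE σ₀ m (m + 1 + k) v

end Summit.BirchSwinnertonDyer.BirchSwinnertonDyer.Cruxes.SplitBadTwoLowerHalfOfFacts.LocalUntwistK3G41

/-! ## §7. R222 SHIFT₂ needs no new theorem: `ϑ(−2 − x) = −π' − ϑ(x)` IS the tree's
`coe_evalPt₁_compSeriesC_reflect` (`LubinTateComparisonReflectionTwo`, ★★); what remains is the INDEX identity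
`ζ^{j+2^n} − 1 = −2 − (ζ^j − 1)` on the `Ĝ_m` side — general `n`, pure algebra, kernel below. -/

namespace Summit.BirchSwinnertonDyer.BirchSwinnertonDyer.Cruxes.SplitBadTwoLowerHalfOfFacts.LocalUntwistK3G41.Shift

variable {R : Type*} [CommRing R] [NoZeroDivisors R]

/-- A primitive `2^{n+1}`-th root of unity has `ζ^{2^n} = −1` (general `n`; k2-g37 did `n = 1, 2` by hand). -/
theorem pow_two_pow_eq_neg_one {n : ℕ} {ζ : R} (hζ : IsPrimitiveRoot ζ (2 ^ (n + 1))) : ζ ^ 2 ^ n = -1 :=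
  (hζ.pow (Nat.two_pow_pos _) (pow_succ 2 n)).eq_neg_one_of_two_right

/-- `−ζ^j = ζ^{j + 2^n}`: the reflection `ε ↦ −ε` is the index shift `j ↦ j + 2^n` on `μ_{2^{n+1}}`. -/
theorem neg_pow_eq_pow_add_two_pow {n : ℕ} {ζ : R} (hζ : IsPrimitiveRoot ζ (2 ^ (n + 1))) (j : ℕ) :
    -ζ ^ j = ζ ^ (j + 2 ^ n) := by
  rw [pow_add, pow_two_pow_eq_neg_one hζ, mul_neg_one]

/-- ★ SHIFT₂, `Ĝ_m` side: `ζ^{j+2^n} − 1 = −2 − (ζ^j − 1)` — verbatim the hypothesis `hx'` of the tree's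
`coe_evalPt₁_compSeriesC_reflect` with `x = ζ^j − 1`, `x' = ζ^{j+2^n} − 1`; its conclusion `ϑ(x') = −π' − ϑ(x)` is
`ϑ(ζ^j − 1) [+]_{f'} ω₁'` (`ω₁' = −π'`, `y [+]_{f'} (−π') = −π' − y` at `q = 2`, tree `coe_tPt_ltDivPt_two`). -/
theorem pow_add_two_pow_sub_one {n : ℕ} {ζ : R} (hζ : IsPrimitiveRoot ζ (2 ^ (n + 1))) (j : ℕ) :
    ζ ^ (j + 2 ^ n) - 1 = -2 - (ζ ^ j - 1) := by
  rw [← neg_pow_eq_pow_add_two_pow hζ j]; ring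

/-- B72 «`γ₀` IS `1 + 2^n`», general `n`, kernel: on the INDEX group the reflection `j ↦ j + 2^n` of an odd index is
MULTIPLICATION by `γ₀ = 1 + 2^n` (not by `−1`; the `−1` above is the field element `ζ^{2^n}`). -/
theorem odd_mul_one_add_two_pow_modEq {n j : ℕ} (hj : Odd j) : j * (1 + 2 ^ n) ≡ j + 2 ^ n [MOD 2 ^ (n + 1)] := by
  obtain ⟨i, rfl⟩ := hj
  have h : (2 * i + 1) * (1 + 2 ^ n) = (2 * i + 1 + 2 ^ n) + 2 ^ (n + 1) * i := by ring
  rw [Nat.ModEq, h, Nat.add_mul_mod_self_left]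

/-- The same in `ZMod (2^{n+1})`: `j·γ₀ = j + 2^n` for odd `j` (the critic `decide`d `N = 4, 8`; here every `n`). -/
theorem odd_mul_gamma0_zmod {n j : ℕ} (hj : Odd j) :
    (j : ZMod (2 ^ (n + 1))) * (1 + 2 ^ n) = j + 2 ^ n := by
  have h := (ZMod.natCast_eq_natCast_iff _ _ _).mpr (odd_mul_one_add_two_pow_modEq (n := n) hj)
  push_cast at h
  exact h

/-- `γ₀² = 1` in `ZMod (2^{n+1})` for `n ≥ 1` (`(1 + 2^n)² = 1 + 2^{n+1} + 2^{2n}`). -/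
theorem gamma0_sq {n : ℕ} (hn : 1 ≤ n) : ((1 + 2 ^ n : ZMod (2 ^ (n + 1)))) ^ 2 = 1 := by
  have h : (1 + 2 ^ n) ^ 2 ≡ 1 [MOD 2 ^ (n + 1)] := by
    obtain ⟨k, rfl⟩ := Nat.exists_eq_add_of_le hn
    have e : (1 + 2 ^ (1 + k)) ^ 2 = 1 + 2 ^ (1 + k + 1) * (1 + 2 ^ k) := by ring
    rw [Nat.ModEq, e, Nat.add_mul_mod_self_left]
  have h' := (ZMod.natCast_eq_natCast_iff _ _ _).mpr h
  push_cast at h'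
  exact h'

end Summit.BirchSwinnertonDyer.BirchSwinnertonDyer.Cruxes.SplitBadTwoLowerHalfOfFacts.LocalUntwistK3G41.Shift
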